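import Literature.NumberTheory.EllipticCurves.CyclotomicZpExtension
import Mathlib.RingTheory.PowerSeries.Binomial
import Mathlib.NumberTheory.Padics.MahlerBasis
import Mathlib.Analysis.Normed.Ring.InfiniteSum
import HarnessLib

/-!
# Evaluating elements of `Λ = ℤ_p⟦T⟧` on the open unit disc of `ℚ_p`

Lang, *Cyclotomic Fields I and II*, Ch. 4 §1 (PDF pp. 78–79): a power series `f ∈ 𝔬⟦X⟧` has a
value `f(z)` at every `z` of the maximal ideal (Thm. 1.2: "`∫ (1+z)^x dμ(x) = f(z)`"; Example 1:
the power series of the Dirac measure at `s` is `∑ (s choose k) X^k = (1 + X)^s`; Example 2: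
`∫_{1+pℤ_p} u^s dν(u) = f(γ^s − 1)`).  In the tree, "the value of `g ∈ Λ` at `z`" is expressed by
`HasSum (fun n ↦ [T^n]g · z^n) (value)` (e.g. the predicates
`GreenbergVatsal2000.IsCharacterLFunctionC/D`).  This file supplies the elementary calculus of such
values, over `ℚ_p` (the `ℂ_p`-versions are in `PAdicPowerSeriesZeros`):

* `summable_norm_intCoeff_mul_pow`, `summable_intCoeff_mul_pow` — absolute convergence for
  `‖z‖ < 1`;
* `hasSum_intCoeff_mul_mul_pow` — **evaluation is multiplicative** (Cauchy product);
* `hasSum_intCoeff_C_mul_pow`, `hasSum_intCoeff_one_mul_pow` — constants;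
* `hasSum_intCoeff_inv_mul_pow` — the value of the inverse of a unit of `Λ` is the inverse value;
* `hasSum_intCoeff_binomialSeries_mul_pow` — **Lang's Example 1 / Example 2**: the binomial series
  `(1 + T)^e = ∑ (e choose n) T^n` (`PowerSeries.binomialSeries ℤ_p e`) takes the value
  `γ^{a e}` at `T = γ^a − 1`, where `x ↦ γ^x` is the tree's `CyclotomicZp.cycPow` (Mathlib's Mahler
  series `PadicInt.addChar_of_value_at_one`).

Everything is proved; there are no named facts.

## References

* S. Lang, *Cyclotomic Fields I and II*, GTM 121, Springer 1990, Ch. 4 §1, Thm. 1.2 and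
  Examples 1–2 (PDF pp. 78–79). [LangCyclotomic1990]
-/

noncomputable section

open Filter Topology PowerSeries

namespace Literature.NumberTheory.EllipticCurves

variable {p : ℕ} [Fact p.Prime]

/-! ### Absolute convergence and multiplicativity -/

/-- For `G ∈ ℤ_p⟦T⟧` and `‖z‖ < 1` in `ℚ_p`, `∑ ‖[T^n]G · z^n‖` converges (domination by a
geometric series; Lang Ch. 4 §1: power series in `𝔬⟦X⟧` converge on the maximal ideal).
[cite: LangCyclotomic1990, Ch. 4 §1, Thm. 1.2 (PDF p. 79)] -/
theorem summable_norm_intCoeff_mul_pow (G : PowerSeries ℤ_[p]) {z : ℚ_[p]} (hz : ‖z‖ < 1) :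
    Summable fun n ↦ ‖((PowerSeries.coeff n G : ℤ_[p]) : ℚ_[p]) * z ^ n‖ := by
  refine Summable.of_nonneg_of_le (fun n ↦ norm_nonneg _) (fun n ↦ ?_)
    (summable_geometric_of_lt_one (norm_nonneg _) hz)
  rw [norm_mul, norm_pow]
  calc _ ≤ 1 * ‖z‖ ^ n := by
        gcongr
        exact (PadicInt.padic_norm_e_of_padicInt _).le.trans (PadicInt.norm_le_one _)
    _ = _ := one_mul _

/-- The evaluation series of `G ∈ ℤ_p⟦T⟧` at `‖z‖ < 1` is summable.
[cite: LangCyclotomic1990, Ch. 4 §1, Thm. 1.2 (PDF p. 79)] -/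
theorem summable_intCoeff_mul_pow (G : PowerSeries ℤ_[p]) {z : ℚ_[p]} (hz : ‖z‖ < 1) :
    Summable fun n ↦ ((PowerSeries.coeff n G : ℤ_[p]) : ℚ_[p]) * z ^ n :=
  (summable_norm_intCoeff_mul_pow G hz).of_norm

/-- **Evaluation on the open unit disc is multiplicative**: if `F(z) = a` and `G(z) = b` then
`(F G)(z) = a b` (Cauchy product of absolutely convergent series in the complete field `ℚ_p`).
[cite: LangCyclotomic1990, Ch. 4 §1, Thm. 1.2 (PDF p. 79)] -/
theorem hasSum_intCoeff_mul_mul_pow {F G : PowerSeries ℤ_[p]} {z : ℚ_[p]} (hz : ‖z‖ < 1)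
    {a b : ℚ_[p]} (hF : HasSum (fun n ↦ ((PowerSeries.coeff n F : ℤ_[p]) : ℚ_[p]) * z ^ n) a)
    (hG : HasSum (fun n ↦ ((PowerSeries.coeff n G : ℤ_[p]) : ℚ_[p]) * z ^ n) b) :
    HasSum (fun n ↦ ((PowerSeries.coeff n (F * G) : ℤ_[p]) : ℚ_[p]) * z ^ n) (a * b) := by
  have hprod := tsum_mul_tsum_eq_tsum_sum_antidiagonal_of_summable_norm
    (summable_norm_intCoeff_mul_pow F hz) (summable_norm_intCoeff_mul_pow G hz)
  rw [hF.tsum_eq, hG.tsum_eq] at hprod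
  have heq : (fun n ↦ ((PowerSeries.coeff n (F * G) : ℤ_[p]) : ℚ_[p]) * z ^ n) =
      fun n ↦ ∑ kl ∈ Finset.antidiagonal n,
        ((PowerSeries.coeff kl.1 F : ℤ_[p]) : ℚ_[p]) * z ^ kl.1 *
          (((PowerSeries.coeff kl.2 G : ℤ_[p]) : ℚ_[p]) * z ^ kl.2) := by
    funext n
    rw [PowerSeries.coeff_mul, PadicInt.coe_sum, Finset.sum_mul]
    refine Finset.sum_congr rfl fun kl hkl ↦ ?_
    rw [Finset.mem_antidiagonal] at hkl
    rw [PadicInt.coe_mul, ← hkl, pow_add]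
    ring
  rw [heq, hprod]
  exact (summable_sum_mul_antidiagonal_of_summable_norm'
    (summable_norm_intCoeff_mul_pow F hz) (summable_intCoeff_mul_pow F hz)
    (summable_norm_intCoeff_mul_pow G hz) (summable_intCoeff_mul_pow G hz)).hasSum

/-- The constant power series `C c` has the value `c` everywhere (Lang Ch. 4 §1: the value
`f(z)` of `f ∈ 𝔬⟦X⟧`, here for a constant `f`). [cite: LangCyclotomic1990, Ch. 4 §1, Thm. 1.2 (PDF p. 79)] -/
theorem hasSum_intCoeff_C_mul_pow (c : ℤ_[p]) (z : ℚ_[p]) :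
    HasSum (fun n ↦ ((PowerSeries.coeff n (PowerSeries.C c) : ℤ_[p]) : ℚ_[p]) * z ^ n) (c : ℚ_[p]) := by
  have h := hasSum_single (f := fun n ↦ ((PowerSeries.coeff n (PowerSeries.C c) : ℤ_[p]) : ℚ_[p]) * z ^ n)
    0 (fun n hn ↦ by rw [PowerSeries.coeff_C, if_neg hn, PadicInt.coe_zero, zero_mul])
  simpa [PowerSeries.coeff_zero_C] using h

/-- The power series `1` has the value `1` everywhere (Lang Ch. 4 §1: the value `f(z)` of
`f ∈ 𝔬⟦X⟧`, here for `f = 1`). [cite: LangCyclotomic1990, Ch. 4 §1, Thm. 1.2 (PDF p. 79)] -/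
theorem hasSum_intCoeff_one_mul_pow (z : ℚ_[p]) :
    HasSum (fun n ↦ ((PowerSeries.coeff n (1 : PowerSeries ℤ_[p]) : ℤ_[p]) : ℚ_[p]) * z ^ n) 1 := by
  have h := hasSum_intCoeff_C_mul_pow (1 : ℤ_[p]) z
  rwa [map_one, PadicInt.coe_one] at h

/-- **The value of the inverse of a unit**: if `h ∈ Λ^×` takes the value `w` at `z`, then `h⁻¹`
takes the value `w⁻¹` (and `w ≠ 0` automatically) — multiplicativity of `f ↦ f(z)` (Lang Ch. 4 §1)
applied to `h h⁻¹ = 1`. [cite: LangCyclotomic1990, Ch. 4 §1, Thm. 1.2 (PDF p. 79)] -/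
theorem hasSum_intCoeff_inv_mul_pow {h : (PowerSeries ℤ_[p])ˣ} {z : ℚ_[p]} (hz : ‖z‖ < 1)
    {w : ℚ_[p]}
    (hh : HasSum (fun n ↦ ((PowerSeries.coeff n (h : PowerSeries ℤ_[p]) : ℤ_[p]) : ℚ_[p]) * z ^ n) w) :
    HasSum (fun n ↦ ((PowerSeries.coeff n (↑h⁻¹ : PowerSeries ℤ_[p]) : ℤ_[p]) : ℚ_[p]) * z ^ n) w⁻¹ := by
  obtain ⟨v, hv⟩ := summable_intCoeff_mul_pow (↑h⁻¹ : PowerSeries ℤ_[p]) hz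
  have hprod := hasSum_intCoeff_mul_mul_pow hz hh hv
  rw [Units.mul_inv] at hprod
  have h1 : w * v = 1 := hprod.unique (hasSum_intCoeff_one_mul_pow z)
  rwa [show w⁻¹ = v from (eq_inv_of_mul_eq_one_right h1).symm]

/-! ### The binomial series `(1 + T)^e` at `T = γ^a − 1` (Lang Ch. 4 §1, Examples 1–2) -/

open CyclotomicZp PadicOneUnits in
/-- **`(1 + T)^e` evaluated at `T = γ^a − 1` is `γ^{ae}`** (Lang Ch. 4 §1, Example 1:
`∑ (s choose k) X^k = (1 + X)^s`; Example 2: `∫ u^s dν = f(γ^s − 1)` with `x ↦ γ^x`): for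
`a, e ∈ ℤ_p`, `∑_n [T^n](binomialSeries ℤ_p e) (γ^a − 1)^n = γ^{ae}`, where `γ^x = cycPow p x` is the
continuous character `ℤ_p → 1 + p^{e₀}ℤ_p` of the tree (Mathlib's Mahler series
`PadicInt.addChar_of_value_at_one`, `PadicOneUnits.oneAddPow_mul`).
[cite: LangCyclotomic1990, Ch. 4 §1, Examples 1–2 (PDF p. 79)] -/
theorem hasSum_intCoeff_binomialSeries_mul_pow (a e : ℤ_[p]) :
    HasSum (fun n ↦ ((PowerSeries.coeff n (PowerSeries.binomialSeries ℤ_[p] e) : ℤ_[p]) : ℚ_[p]) *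
        (((cycPow p a : ℤ_[p]) : ℚ_[p]) - 1) ^ n)
      (((cycPow p (a * e) : ℤ_[p]) : ℚ_[p])) := by
  set r : ℤ_[p] := cycPow p a - 1 with hr
  have hrn : ‖r‖ < 1 := norm_oneAddPow_sub_one_lt_one _ a
  have hr0 : Tendsto (fun n ↦ r ^ n) atTop (𝓝 0) := tendsto_pow_of_norm_lt_one hrn
  -- `γ^{ae} = mahlerSeries (r^·) e = ∑' n (e choose n) r^n` in `ℤ_p`
  have hval : cycPow p (a * e) = ∑' n, Ring.choose e n * r ^ n := by
    have h1 : cycPow p (a * e) = PadicInt.addChar_of_value_at_one r hr0 e := oneAddPow_mul _ a e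
    rw [h1, PadicInt.coe_addChar_of_value_at_one, PadicInt.mahlerSeries_apply hr0]
    simp only [mahler_apply, smul_eq_mul]
  have hsumm : Summable fun n ↦ Ring.choose e n * r ^ n := by
    refine NonarchimedeanAddGroup.summable_of_tendsto_cofinite_zero ?_
    rw [Nat.cofinite_eq_atTop, tendsto_zero_iff_norm_tendsto_zero]
    have h0 : Tendsto (fun n ↦ ‖r‖ ^ n) atTop (𝓝 0) :=
      tendsto_pow_atTop_nhds_zero_of_lt_one (norm_nonneg _) hrn
    refine squeeze_zero (fun n ↦ norm_nonneg _) (fun n ↦ ?_) h0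
    rw [norm_mul, norm_pow]
    calc _ ≤ 1 * ‖r‖ ^ n := by gcongr; exact PadicInt.norm_le_one _
      _ = _ := one_mul _
  have hZ : HasSum (fun n ↦ Ring.choose e n * r ^ n) (cycPow p (a * e)) := by
    rw [hval]; exact hsumm.hasSum
  have hQ := hZ.map (PadicInt.Coe.ringHom (p := p)).toAddMonoidHom continuous_subtype_val
  refine HasSum.congr_fun hQ fun n ↦ ?_
  simp only [Function.comp_apply, RingHom.toAddMonoidHom_eq_coe, AddMonoidHom.coe_coe,
    PadicInt.Coe.ringHom, binomialSeries_coeff, smul_eq_mul, mul_one, hr]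
  rfl

end Literature.NumberTheory.EllipticCurves

end
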